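import Mathlib
import Summits.CriticalPhenomena.CardyFormulaZ2.Theses.CardyAnchoredRigidity

/-!
# Route CardyAnchoredRigidity — `AnchoringClassification` (item stmt-CriticalPhenomena-12843)

The `m = 2` harmonic classification behind the Anchoring Lemma (card P1(i)): a field `N : ℂ → ℂ`
with `N (r e^{iθ} w) = e^{2iθ} N w` for all `r > 0`, `θ ∈ ℝ`, `w ≠ 0` satisfies
`N w = N 1 · w / w̄` for every `w ≠ 0`.

Proof: write `w = ‖w‖ · e^{i arg w} · 1` (polar form, `Complex.norm_mul_exp_arg_mul_I`), apply the
covariance hypothesis at the base point `1`, and identify `e^{2 i arg w}` with `w / w̄` using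
`w̄ = ‖w‖ · e^{-i arg w}`. Elementary; no named facts.
-/

namespace Summit.CriticalPhenomena.CardyFormulaZ2.Theorems

open Summit.CriticalPhenomena.CardyFormulaZ2.Theses.CardyAnchoredRigidity

/-- **AnchoringClassification** (route CardyAnchoredRigidity, item stmt-CriticalPhenomena-12843):
every field `N : ℂ → ℂ` that is degree-2 rotation covariant and dilation invariant away from the
origin, `N (r e^{iθ} w) = e^{2iθ} N w` (`r > 0`, `θ ∈ ℝ`, `w ≠ 0`), is the target-anchored
Beltrami field `N w = N 1 · w / w̄` on `w ≠ 0`. Polar decomposition of `w` and the hypothesis at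
the base point `1`. -/
theorem anchoringClassification_proof : AnchoringClassification := by
  unfold AnchoringClassification
  intro N hN w hw
  have hr : 0 < ‖w‖ := norm_pos_iff.mpr hw
  -- polar form of `w` and of its conjugate
  have hpol : (‖w‖ : ℂ) * Complex.exp ((Complex.arg w : ℂ) * Complex.I) = w :=
    Complex.norm_mul_exp_arg_mul_I w
  have hconj : (starRingEnd ℂ) w =
      (‖w‖ : ℂ) * Complex.exp (-((Complex.arg w : ℂ) * Complex.I)) := by
    conv_lhs => rw [← hpol]
    rw [map_mul, Complex.conj_ofReal, ← Complex.exp_conj, map_mul, Complex.conj_ofReal,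
      Complex.conj_I, mul_neg]
  have hconj_ne : (starRingEnd ℂ) w ≠ 0 :=
    (map_ne_zero_iff (starRingEnd ℂ) (RingHom.injective _)).mpr hw
  -- the hypothesis at the base point `1`
  have key := hN 1 one_ne_zero ‖w‖ (Complex.arg w) hr
  rw [mul_one, hpol] at key
  rw [key, mul_comm]
  congr 1
  -- `e^{2 i arg w} = w / w̄`
  rw [eq_div_iff hconj_ne, hconj, mul_left_comm, ← Complex.exp_add]
  have h2 : 2 * (Complex.arg w : ℂ) * Complex.I + -((Complex.arg w : ℂ) * Complex.I) =
      (Complex.arg w : ℂ) * Complex.I := by ring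
  rw [h2]
  exact hpol

end Summit.CriticalPhenomena.CardyFormulaZ2.Theorems
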